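import Mathlib
import Summits.QuantumFields.BalabanUV.Beta.EriceRemainderEnclosureHistoryAutonomyComparisonAgeCompositionStaticChainPairStepLattice
import Summits.QuantumFields.BalabanUV.Beta.EriceRemainderEnclosureHistoryAutonomyComparisonAgeCompositionStaticChainBandsMid

/-!
# EriceRemainderEnclosureHistoryAutonomyComparisonAgeCompositionStaticChainPairTemplate — (E79y) THE PAIR TEMPLATE: the observer step (◆) above ONE given pair
# `(y, z)` from one existential package of rational constants and numeric facts about that pair (exact `r = z∕y`; natural defect hypothesis `θ ≤ θ̄(y∕z)`) —
# for the finitely many pairs below the band thresholds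

Cell `pub-balaban`, β-function sub-cell, BINDER row D4 «RemainderConst leaves for Bałaban's split» (`HOME/BINDER-OWNERS.md`; owner lineage `b2b-balaban-beta-an4`;
this file by co-owner #2 lineage `b2b-balaban-beta-d4-p2`, generation 70), β-FLOW TEAM duty (1), FREEZE (0) honoured (def-free; imports (E79b) `…PairStepLattice`
(`pair_step_lattice`), (E79n) `…BandsMid` (`thetabar_le_band`), (E78e) `lam1_ge`∕`lam2_ge` via the band chain; nothing restated).

HONEST FRAMING (page 1, verbatim and binding).  *"Discharging BetaPertH makes Bałaban's UV stability UNCONDITIONAL — a real constructive-QFT result; it is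
NOT the continuum limit and NOT the Clay problem."*  THIS FILE DISCHARGES NOTHING OF THE KIND.  Finite non-negative linear∕real algebra — hypotheses of a census,
not facts; the age profile of Bałaban's (1.22) limit functional is NOT PRINTED ([I] p. 298; GAPS G-t4-U2-1∕-2) and NOT asserted.  Row D4 class UNCHANGED
(critical-path width 0; instance 0∕1; D4 DISCHARGE NO DATE).  HONEST DEPENDENCY: continuum YM on T⁴ ⇐ BetaPertH ∧ nine spine estimates (0/9 proved); BetaPertH ⇐
(D1) ∧ (D4) ∧ CAP+tail; G-an2-4 gates asym, D1 and NE2/3/4.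

THE POINT (census sense (α); route (N′); README `HOME/b2b-balaban-beta-d4-p2/g70/e79/README.md` §4).  After the band capstones ((E79g) adjacent, (E79t) `y ≥ 24`
for `q ≤ 8`, and the low-threshold half-constant bands (E79u–x, E79r∕s) for `y ≥ 8∕12∕16`), exactly 27 non-adjacent pairs with `q ≤ 8` lie below every
threshold: `(3,1) (4,1) (4,2) (5,1) (5,2) (5,3) (6,1) (6,2) (6,3) (6,4) (7,1) (7,2) (7,3) (7,4) (7,5) (8,1) (9,7) (10,8) (11,9) (14,2) (14,12) (15,2) (15,13)
(16,2) (21,3) (22,3) (23,3)` (`g70/numerics`: enumeration in NOTES).  This template serves them one package each: **`pair_pair_step_lattice`** = (E79c)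
`adjacent_pair_step_lattice` with `y` free, `r = z∕y` exact, and the defect constant justified INSIDE the package (`Lc ≤ √(q∕(q+1))`, `1 − c·Lc·(1 − 1∕(2q)) ≤ th`,
(E79n) `thetabar_le_band` at `ql = q`), so that its defect hypothesis is the natural `θ ≤ θ̄(y∕z)`.  Every one of the 27 closes with all coefficients positive
(`numerics/pairnum.py`; ratio ends termwise for `z = 1`, closed-form otherwise).  NOT CLAIMED: the packages (E79z…); the union theorem; anything printed.

WHAT IS PROVED ([folklore]; 0 `def`, 0 sorry).  **`pair_pair_step_lattice`**.
-/
noncomputable section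
open Finset

namespace Summit.QuantumFields.BalabanUV.Beta.EriceRemainderEnclosureHistoryAutonomyComparisonAgeCompositionStaticChainPairTemplate

open Summit.QuantumFields.BalabanUV.Beta.EriceRemainderEnclosureHistoryAutonomyComparisonAgeCompositionStaticChainAdjacentEnvelopes
open Summit.QuantumFields.BalabanUV.Beta.EriceRemainderEnclosureHistoryAutonomyComparisonAgeCompositionStaticChainPairStepLattice
open Summit.QuantumFields.BalabanUV.Beta.EriceRemainderEnclosureHistoryAutonomyComparisonAgeCompositionStaticChainBandsMid

/-- **THE PAIR TEMPLATE.**  For a pair `y > z ≥ 1` and any level-coupled configuration above it (letters of (E79b) `pair_step_lattice`), the observer step (◆)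
with `κ = 31∕40` and the NATURAL defect hypothesis `θ ≤ θ̄(y∕z)` FOLLOWS FROM ONE EXISTENTIAL PACKAGE of thirteen rationals `sl su fl fu slo au bl bu cl ch D th Lc`
with: the envelope facts of the pair, the observer-ratio ends, `bl²z ≤ y`, the box roundings (`r = z∕y` exact, covariance constant 1), the defect rounding
`Lc ≤ √(q∕(q+1))`, `1 − (q∕(q+1))·Lc·(1 − 1∕(2q)) ≤ th` (`q = y∕z`; (E79n) `thetabar_le_band`), and the nine polynomial facts of (E79a) (`l1 = 549∕400`,
`l2 = 2071∕1250`).  Proof: (E79b) `pair_step_lattice`. [folklore] -/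
theorem pair_pair_step_lattice {n y z : ℕ} {k : ℕ → ℕ} {x a cy cz Sy Sz Ry Rz : ℕ → ℝ} {θ xy Ψyy Ψyz Ψzy Ψzz Ωz σ φ s : ℝ}
    (hz : 1 ≤ z) (hzy : z + 1 ≤ y)
    (hfacts : ∃ sl su fl fu slo au bl bu cl ch D th Lc : ℝ,
      0 ≤ sl ∧ sl * (y : ℝ) ≤ ∑ m ∈ range z, Real.sqrt ((y : ℝ) / ((y : ℝ) + m + 1)) ∧ ∑ m ∈ range z, Real.sqrt ((y : ℝ) / ((y : ℝ) + m + 1)) ≤ su * (y : ℝ) ∧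
      0 ≤ fl ∧ fl * (z : ℝ) ≤ ∑ m ∈ range y, Real.sqrt ((z : ℝ) / ((z : ℝ) + m + 1)) ∧ ∑ m ∈ range y, Real.sqrt ((z : ℝ) / ((z : ℝ) + m + 1)) ≤ fu * (z : ℝ) ∧
      1 / 2 ≤ slo ∧ slo * (y : ℝ) ≤ ∑ m ∈ range y, Real.sqrt ((y : ℝ) / ((y : ℝ) + m + 1)) ∧
      ∑ m ∈ range z, Real.sqrt (((y : ℝ) + 1) / (((y : ℝ) + 1) + m + 1)) ≤ au * ∑ m ∈ range y, Real.sqrt (((y : ℝ) + 1) / (((y : ℝ) + 1) + m + 1)) ∧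
      0 ≤ bl ∧ bl ^ 2 * (z : ℝ) ≤ (y : ℝ) ∧
      (y : ℝ) * ∑ m ∈ range (y + 1), Real.sqrt ((z : ℝ) / ((z : ℝ) + m + 1)) ≤ bu * ((z : ℝ) * ∑ m ∈ range (y + 1), Real.sqrt ((y : ℝ) / ((y : ℝ) + m + 1))) ∧
      0 ≤ cl ∧ cl ≤ (z : ℝ) / (y : ℝ) * bl ∧ au * bu ≤ ch ∧ (au - (z : ℝ) / (y : ℝ)) * (bu - bl) ≤ D ∧
      Lc ≤ Real.sqrt (((y : ℝ) / (z : ℝ)) / (((y : ℝ) / (z : ℝ)) + 1)) ∧ 1 - ((y : ℝ) / (z : ℝ)) / (((y : ℝ) / (z : ℝ)) + 1) * Lc * (1 - 1 / (2 * ((y : ℝ) / (z : ℝ)))) ≤ th ∧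
      (∀ Ψ : ℝ, 0 ≤ Ψ → 0 ≤ 4 * (31/40:ℝ) * ((549/400:ℝ) + ((2071/1250:ℝ) - (z : ℝ) / (y : ℝ)) * Ψ) * (sl * fl + sl * bl * Ψ + fl * ((z : ℝ) / (y : ℝ)) * Ψ + Ψ * (cl * Ψ) - D * Ψ ^ 2)
        - (1 + 2 * (31/40:ℝ) * Ψ) * ((1 + 2 * (31/40:ℝ) * (cl * Ψ)) * ((549/400:ℝ) + ((2071/1250:ℝ) - (z : ℝ) / (y : ℝ)) * Ψ) - (1 - th) * ((549/400:ℝ) + (2071/1250:ℝ) * Ψ)) - (1 + 2 * (31/40:ℝ) * (cl * Ψ)) * ((z : ℝ) / (y : ℝ)) * ((549/400:ℝ) + (2071/1250:ℝ) * Ψ)) ∧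
      (∀ Ψ : ℝ, 0 ≤ Ψ → 0 ≤ 4 * (31/40:ℝ) * ((549/400:ℝ) + ((2071/1250:ℝ) - (z : ℝ) / (y : ℝ)) * Ψ) * (sl * fl + sl * bl * Ψ + fl * ((z : ℝ) / (y : ℝ)) * Ψ + Ψ * (ch * Ψ) - D * Ψ ^ 2)
        - (1 + 2 * (31/40:ℝ) * Ψ) * ((1 + 2 * (31/40:ℝ) * (ch * Ψ)) * ((549/400:ℝ) + ((2071/1250:ℝ) - (z : ℝ) / (y : ℝ)) * Ψ) - (1 - th) * ((549/400:ℝ) + (2071/1250:ℝ) * Ψ)) - (1 + 2 * (31/40:ℝ) * (ch * Ψ)) * ((z : ℝ) / (y : ℝ)) * ((549/400:ℝ) + (2071/1250:ℝ) * Ψ)) ∧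
      (∀ Ψ : ℝ, 0 ≤ Ψ → 0 ≤ 4 * (31/40:ℝ) * (sl * fl + sl * bl * Ψ + fl * ((z : ℝ) / (y : ℝ)) * Ψ + Ψ * (cl * Ψ) - D * Ψ ^ 2)
        - (1 + 2 * (31/40:ℝ) * Ψ) * ((1 + 2 * (31/40:ℝ) * (cl * Ψ)) - (1 - th)) - (1 + 2 * (31/40:ℝ) * (cl * Ψ)) * ((z : ℝ) / (y : ℝ))) ∧
      (∀ Ψ : ℝ, 0 ≤ Ψ → 0 ≤ 4 * (31/40:ℝ) * (sl * fl + sl * bl * Ψ + fl * ((z : ℝ) / (y : ℝ)) * Ψ + Ψ * (ch * Ψ) - D * Ψ ^ 2)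
        - (1 + 2 * (31/40:ℝ) * Ψ) * ((1 + 2 * (31/40:ℝ) * (ch * Ψ)) - (1 - th)) - (1 + 2 * (31/40:ℝ) * (ch * Ψ)) * ((z : ℝ) / (y : ℝ))) ∧
      (∀ Ψ : ℝ, 0 ≤ Ψ → 0 ≤ (1 + 2 * (31/40:ℝ) * (cl * Ψ)) * (1 + 2 * (31/40:ℝ) * Ψ) * ((z : ℝ) / (y : ℝ)) * ((549/400:ℝ) + (2071/1250:ℝ) * Ψ)
        - 4 * (31/40:ℝ) * (su * fu + su * bu * Ψ + fu * au * Ψ + Ψ * (cl * Ψ) + D * Ψ ^ 2) * ((1 + 2 * (31/40:ℝ) * Ψ - 2 * slo - 2 * Ψ) * ((549/400:ℝ) + ((2071/1250:ℝ) - (z : ℝ) / (y : ℝ)) * Ψ) + ((z : ℝ) / (y : ℝ)) * ((549/400:ℝ) + (2071/1250:ℝ) * Ψ))) ∧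
      (∀ Ψ : ℝ, 0 ≤ Ψ → 0 ≤ (1 + 2 * (31/40:ℝ) * (ch * Ψ)) * (1 + 2 * (31/40:ℝ) * Ψ) * ((z : ℝ) / (y : ℝ)) * ((549/400:ℝ) + (2071/1250:ℝ) * Ψ)
        - 4 * (31/40:ℝ) * (su * fu + su * bu * Ψ + fu * au * Ψ + Ψ * (ch * Ψ) + D * Ψ ^ 2) * ((1 + 2 * (31/40:ℝ) * Ψ - 2 * slo - 2 * Ψ) * ((549/400:ℝ) + ((2071/1250:ℝ) - (z : ℝ) / (y : ℝ)) * Ψ) + ((z : ℝ) / (y : ℝ)) * ((549/400:ℝ) + (2071/1250:ℝ) * Ψ))) ∧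
      (∀ Ψ : ℝ, 0 ≤ Ψ → ((z : ℝ) / (y : ℝ)) * ((549/400:ℝ) + (2071/1250:ℝ) * Ψ) ≤ 2 * (slo + Ψ) * ((549/400:ℝ) + ((2071/1250:ℝ) - (z : ℝ) / (y : ℝ)) * Ψ)))
    (hn : 0 < n) (hk : ∀ l, l < n → y + 1 ≤ k l) (hx : ∀ l, l < n → 0 ≤ x l)
    (hSy : ∀ l, l < n → Sy l = ∑ m ∈ range y, Real.sqrt ((k l : ℝ) / ((k l : ℝ) + m + 1)))
    (hSz : ∀ l, l < n → Sz l = ∑ m ∈ range z, Real.sqrt ((k l : ℝ) / ((k l : ℝ) + m + 1)))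
    (hRy : ∀ l, l < n → Ry l = ∑ m ∈ range (k l), Real.sqrt ((y : ℝ) / ((y : ℝ) + m + 1)))
    (hRz : ∀ l, l < n → Rz l = ∑ m ∈ range (k l), Real.sqrt ((z : ℝ) / ((z : ℝ) + m + 1)))
    (ha0 : ∀ i, i < n → 0 < a i)
    (ha : ∀ i, i < n → a i = 1 + ∑ l ∈ range n,
      (2 * x l * (∑ m ∈ range (k i), Real.sqrt ((k l : ℝ) / ((k l : ℝ) + m + 1))) / k l) * a l)
    (hcy : ∀ i, i < n → cy i = Ry i / (y : ℝ) + ∑ l ∈ range n,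
      (2 * x l * (∑ m ∈ range (k i), Real.sqrt ((k l : ℝ) / ((k l : ℝ) + m + 1))) / k l) * cy l)
    (hcz : ∀ i, i < n → cz i = Rz i / (z : ℝ) + ∑ l ∈ range n,
      (2 * x l * (∑ m ∈ range (k i), Real.sqrt ((k l : ℝ) / ((k l : ℝ) + m + 1))) / k l) * cz l)
    (hΨyy : Ψyy = ∑ l ∈ range n, (2 * x l * Sy l / k l) * cy l) (hΨyz : Ψyz = ∑ l ∈ range n, (2 * x l * Sz l / k l) * cy l)
    (hΨzy : Ψzy = ∑ l ∈ range n, (2 * x l * Sy l / k l) * cz l) (hΨzz : Ψzz = ∑ l ∈ range n, (2 * x l * Sz l / k l) * cz l)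
    (hΩz : Ωz = ∑ l ∈ range n, x l * (z : ℝ) / k l)
    (hσ : σ = (∑ m ∈ range z, Real.sqrt ((y : ℝ) / ((y : ℝ) + m + 1))) / (y : ℝ))
    (hφ : φ = (∑ m ∈ range y, Real.sqrt ((z : ℝ) / ((z : ℝ) + m + 1))) / (z : ℝ))
    (hs : s = (∑ m ∈ range y, Real.sqrt ((y : ℝ) / ((y : ℝ) + m + 1))) / (y : ℝ))
    (hθ : θ ≤ 1 - ((y : ℝ) / z) / ((y : ℝ) / z + 1) * Real.sqrt (((y : ℝ) / z) / ((y : ℝ) / z + 1)) * Real.exp (-(1 / (2 * ((y : ℝ) / z)))))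
    (hxy : 0 ≤ xy) (hcap : 2 * xy * (s + Ψyy) < 1) :
    (1 + 2 * (31/40:ℝ) * Ψzz) * (1 - Ωz) - (1 - θ) * (xy * (1 + 2 * (31/40:ℝ) * Ψyy))
      ≤ (1 - xy * (1 + 2 * (31/40:ℝ) * Ψyy)) *
        ((1 + 2 * (31/40:ℝ) * Ψzz + 4 * (31/40:ℝ) * xy * ((σ + Ψyz) * (φ + Ψzy)) / (1 - 2 * (s + Ψyy) * xy)) * ((1 - Ωz) - xy / ((y : ℝ) / (z : ℝ)))) := by
  obtain ⟨sl, su, fl, fu, slo, au, bl, bu, cl, ch, D, th, Lc, hsl0, hsl, hsu, hfl0, hfl, hfu, hslo, hslo', hau, hbl0, hbl, hbu, hcl0, hcl, hch, hD,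
    hLc, hth, hFs_lo, hFs_hi, hF1_lo, hF1_hi, hG_lo, hG_hi, hpole⟩ := hfacts
  have hy1 : 1 ≤ y := by omega
  have hzp : (0 : ℝ) < z := by exact_mod_cast (show 0 < z by omega)
  have hzy' : (z : ℝ) + 1 ≤ y := by exact_mod_cast hzy
  have hyp : (0 : ℝ) < y := by linarith
  have hq1 : (1 : ℝ) ≤ (y : ℝ) / z := by rw [le_div_iff₀ hzp]; linarith
  have hl1 := lam1_ge (y := y) hy1
  have hl2 := lam2_ge (y := y) hy1
  have hr2 : (z : ℝ) / y ≤ 2071 / 1250 := by rw [div_le_iff₀ hyp]; linarith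
  have hθ' : θ ≤ th := hθ.trans (thetabar_le_band (ql := (y : ℝ) / z) (by positivity) le_rfl hLc (by linarith) hth)
  exact pair_step_lattice (κ := 31/40) (r := (z : ℝ) / y) (th := th) (l1 := 549/400) (l2 := 2071/1250)
    (sl := sl) (su := su) (fl := fl) (fu := fu) (slo := slo) (au := au) (bl := bl) (bu := bu) (cl := cl) (ch := ch) (D := D)
    (by norm_num) (by norm_num) hn hz hzy hk hx hSy hSz hRy hRz ha0 ha hcy hcz hΨyy hΨyz hΨzy hΨzz hΩz hσ hφ hs rfl hθ' hxy hcap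
    hsl0 hsl hsu hfl0 hfl hfu hslo hslo' hau hbl0 hbl hbu hcl0 hcl hch hD (by norm_num) hl1 hr2 hl2
    hFs_lo hFs_hi hF1_lo hF1_hi hG_lo hG_hi hpole

end Summit.QuantumFields.BalabanUV.Beta.EriceRemainderEnclosureHistoryAutonomyComparisonAgeCompositionStaticChainPairTemplate

end
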